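/-
Origin: expansion seat `prover-pub-hodgecm-mc-binder-1-g19-0`, handover #R131r2 2026-08-21T04:47:53Z md5 390c9406c200 (352 l.; REPLACE-EXTEND of the RUN-71 install (r1 body 5092c7d41467): `def pinDatum{Zero,One,Two,Three}R2` → `abbrev` (reducible) + one docstring sentence; 14 ∕ 14 names and all statements unchanged; imports unchanged (#R130 + #CA60 + #1216); reason: socket inference of `hdef` through the extra def layer (probe `mc/pub-hodgecm-mc-binder-1-g19/probe/PinR2Unify.lean`); NAMES for audit (unchanged, already audited RUN 71): HodgeCM.Model.SInstance.clsU_mem_iSup_block_of_mem_adelicThetaSpanSat_ROGT'C_zero · HodgeCM.Model.SInstance.clsU_mem_iSup_block_of_mem_adelicThetaSpanSat_ROGT'C_one · HodgeCM.Model.SInstance.clsU_mem_iSup_block_of_mem_holSat_ROGT'C_one; NAME LIST: (none new — REPLACE keeps the 3 audited theorem names byte-identical)) (`HOME/mc/pub-hodgecm-mc-binder-1-g19/stage72/HodgeCM/Model/AdelicThetaDistributionMultPinR2.lean`, md5 390c9406c200, 352 lines);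
landed by the second packager p2 gen 18 (p2-g18) in gate run 72 REPLACES the earlier landed copy of `HodgeCM/Model/AdelicThetaDistributionMultPinR2.lean` (verbatim).
-/
/-
Copyright (c) 2026 the pub-hodgecm formalisation cell (harness21).  New file, not vendored.
Origin: session prover-pub-hodgecm-mc-binder-1-g19-0 (unit pub-hodgecm-mc-binder-1-g19, BINDER PROVER gen 19; binder-1's (J4) pin data and `hfam`
clause-2 block theorems INSTANTIATED AT THE R2 PIN OF RECORD `SInstance.SROGT'C …` (lead 1-g84 ROUTING WORD (R2-PIN) STATUS l.15023), all four slots,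
with EVERY pin identity discharged by the landed row-12 sockets of sinst-1 ∕ carch (#1216 `hχ/hdef_zero/one_ROGTC`, #CA55
`hχ/hdef_two/three_R2_of_GOG`, `defExponent_k_spec`) — «what the R2 pin still owes is ONLY its own instantiation line» (binder-2-g20 STATUS l.15101):
this is that line, on the binder-1 side), 2026-08-21.
Intended final place: `HodgeCM/Model/AdelicThetaDistributionMultPinR2.lean` (NEW additive model-layer leaf; imports binder-1's
`HodgeCM.Model.AdelicThetaDistributionMultSpanG` (#R130) and the LANDED pin files `HodgeCM.Model.ThetaAdelicSideGuardedT2Ops` (#CA60; brings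
#1229 `ThetaAdelicSideR2`: `SROGT'C_ιinf`, `SROGT'C_Gfin`, `SROGT'C_P_ω`) ∕ `HodgeCM.Model.ThetaAdelicSideR1` (#1216); nothing imports it; drop alone).
-/
import Summits.HodgeConjecture.HodgeCM.Model.AdelicThetaDistributionMultSpanG_2
import Summits.HodgeConjecture.HodgeCM.Model.ThetaAdelicSideGuardedT2Ops_2
import Summits.HodgeConjecture.HodgeCM.Model.ThetaAdelicSideR1

set_option autoImplicit false

/-!
# `hfam` clause 2 AT THE R2 PIN OF RECORD `SInstance.SROGT'C`, all four slots, no pin hypothesis left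

For the constructed row-5 pin `S := SInstance.SROGT'C @hGR @hGR₀ @hGR₁ @hGR₂ @hGR₃ @μ hΔ₁ hΔ₂ hΔ₃ V c` (inputs: the five [GR91 3.1.1]
splitting families, E's `μ` table, the three guarded (J-μ) identities) under E's OG guard `hc : GOG V c`:
* § 0 the side facts of the pin as named lemmas (`hι` is carch's landed `SROGT'C_ιinf`, #CA60 `ThetaAdelicSideGuardedT2Ops`): `SROGT'C_P_ω_lineRepOf`
  (`(P k).ω = lineRepOf … (etaT₀ η ν) (etaT₁ η ν) (etaT₂ η ν′) (etaT₃ η ν′) k` at `η := EtaChi.η χVR (χWR μ) V c`, `ν := νR V c`, `ν′ := ν'R V c`;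
  #1229 `SROGT'C_P_ω` + period-1 `archSideOfT'_P_ω`), `satG_le_SROGT'C_Gfin` (`hGfin`, from the landed `SROGT'C_Gfin : Gfin = archFinOf V`);
* § 1–4 **`pinDatum{Zero,One,Two,Three}R2 … V c hc hV : ThetaDistDatum (SROGT'C … V c) hV k`** := binder-1 #R129 `pinDatum_kG` at that side and
  those characters with ALL pin data supplied by landed theorems: `hι`/`hP` (§ 0), `h₁W := hG_GOG V c hc`, `hemb := hc.1`,
  `hχc := continuous_etaT_k …`, `eR/eS := posIdxEquivUnit/negIdxEquivEmpty (hpos_GOG V c hc).k`, `hχ := hχ_k_ROGTC` ∕ `hχ_k_R2_of_GOG`,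
  `a := defExponent_k …`, `hω := defExponent_k_spec …`, `hdefI := hdef_k_ROGTC` ∕ `hdef_k_R2_of_GOG`;
  **`clsU_mem_iSup_block_of_mem_adelicThetaSpanSat_ROGT'C_{zero,one,two,three} (hc) (hV) (h𝓕) K hF`**: for weight functions `𝓕 ⊆ {charInv χ}`,
  EVERY `F ∈ adelicThetaSpanSat ((SROGT'C … V c).P k) (SROGT'C … V c).ιinf _ _ (satG hV K) 𝓕` lies in `holSatU` and its tower class lies in
  `⨆_{χ, charInv χ ∈ 𝓕} ⨆_{ψ : ((pinDatum_kR2 …).coinvRep χ).asModule →ₗ Tower} range ψ` — #R130 `…_pin_kG` with `hGfin := satG_le_SROGT'C_Gfin`,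
  `hLF := hLF_ROGT'C`; and the `holSat Γ` form `clsU_mem_iSup_block_of_mem_holSat_ROGT'C_k (hc) (hV) (h𝓕) Γ hF` (`K := Γ.K`, `hF.1`).
  HYPOTHESES LEFT: the pin's own inputs (`hGR×5`, `μ`, `hΔ₁ hΔ₂ hΔ₃`), the guard `hc : GOG V c`, `hV`, `h𝓕` — NO pin identity, NO multiplicity ∕
  archimedean-operator hypothesis, nothing cited.
KERNEL only: four `abbrev`s (REDUCIBLE terms of the #1246 structure via #R129/#1262 — r2: `def` → `abbrev`, so that sinst-1's G-datum
sockets `dictEquivOneCanonicalG … _ _ _ χ` etc. infer `Φarch`/`harm`/`hdef` against `((pinDatum_kR2 …).coinvRep χ).asModule` by unification;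
with the r1 `def` the proof argument `hdef` had to be passed explicitly) + theorems; 0 records, 0 `def … : Prop`; `#print axioms` ⊆
{propext, Classical.choice, Quot.sound}.
-/

noncomputable section

open NumberField hiding relNormOneIdeles relNormOneRat probHaarRelNormOneQuot
open _root_.NumberField.InfinitePlace _root_.NumberField.mixedEmbedding MeasureTheory MulAction IsDedekindDomain
open scoped Matrix TensorProduct Classical SchwartzMap
open Literature.Geometry.ComplexHyperbolic.BallModel (U21 x₀ stabilizerEquivK21)
open Literature.NumberTheory.Automorphic.U21 (K21 matA sclD)
open Literature.NumberTheory.Automorphic Literature.NumberTheory.Automorphic.UnitaryGroup Literature.NumberTheory.Weil1964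
open Literature.NumberTheory.GelbartRogawski1991 Literature.NumberTheory.GelbartRogawski1991.UnitaryDualPair
open Literature.AlgebraicGeometry.HodgeTheory Literature.AlgebraicGeometry.ShimuraVarieties Literature.AlgebraicGeometry.ShimuraVarieties.BallForms
open Literature.NumberTheory.Automorphic.PicardCM
open Literature.NumberTheory.Transcendental (Arapura2012_Cor_15_4_6)
open Literature.Analysis.SegalBargmann
open HodgeCM.Adelic HodgeCM.PerL34 HodgeCM.Model.HypCensus HodgeCM.Model.ArchSideTerm HodgeCM.Model.ThetaDistFin HodgeCM.Model.TowerCarrier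
open HodgeCM.Model.SupplyInstance HodgeCM.Model.SupplyResidual HodgeCM.Model.ThetaSpace
open HodgeCM.Model.SupplyResidual.WeilPairData (charInv)
open HodgeCM.Model.ThetaAdelicSide

namespace HodgeCM.Model.SInstance

variable (hHD : exists_isReal_hodgeModel) (hI : hodgePQ_independent_of_hodgeModel)
  (h₁ : BallQuotientUniformised) (h₃ : CMAbelianVarietyRealised) (hA : Arapura2012_Cor_15_4_6)
variable
  (hGR : ∀ {L : CMField} {ι₁ : L →+* ℂ} (V : HermSpace3 L ι₁) (c : SeesawCtx L),
    (cmSplittingDatum (L : Type) finProdFinEquiv (frameD V) (frameD_real V) (frameD_ne V) (dW c.D) (dW_real c.D)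
      (dW_ne c.D)).CompatibleSplitting)
  (hGR₀ : ∀ {L : CMField} {ι₁ : L →+* ℂ} (V : HermSpace3 L ι₁) (c : SeesawCtx L),
    (cmSplittingDatum (L : Type) (ArchSideTerm.e₁) (frameD V) (frameD_real V) (frameD_ne V) (lineVec (L : Type) (dW c.D 0))
      (fun _ => dW_real c.D 0) (fun _ => dW_ne c.D 0)).CompatibleSplitting)
  (hGR₁ : ∀ {L : CMField} {ι₁ : L →+* ℂ} (V : HermSpace3 L ι₁) (c : SeesawCtx L),
    (cmSplittingDatum (L : Type) (ArchSideTerm.e₁) (frameD V) (frameD_real V) (frameD_ne V) (lineVec (L : Type) (dW c.D 1))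
      (fun _ => dW_real c.D 1) (fun _ => dW_ne c.D 1)).CompatibleSplitting)
  (hGR₂ : ∀ {L : CMField} {ι₁ : L →+* ℂ} (V : HermSpace3 L ι₁) (c : SeesawCtx L),
    (cmSplittingDatum (L : Type) (ArchSideTerm.e₁) (frameD V) (frameD_real V) (frameD_ne V) (lineVec (L : Type) (dW' c.D 0))
      (fun _ => dW'_real c.D 0) (fun _ => dW'_ne c.D 0)).CompatibleSplitting)
  (hGR₃ : ∀ {L : CMField} {ι₁ : L →+* ℂ} (V : HermSpace3 L ι₁) (c : SeesawCtx L),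
    (cmSplittingDatum (L : Type) (ArchSideTerm.e₁) (frameD V) (frameD_real V) (frameD_ne V) (lineVec (L : Type) (dW' c.D 1))
      (fun _ => dW'_real c.D 1) (fun _ => dW'_ne c.D 1)).CompatibleSplitting)
  (μ : ∀ {L : CMField}, SeesawCtx L → Fin 4 → NumberField.InfinitePlace (L : Type) → ℤ)
  (hΔ₁ : ∀ {L : CMField} {ι₁ : L →+* ℂ} (V : HermSpace3 L ι₁) (c : SeesawCtx L), ∀ hc : GOG V c,
    slotTypeVec V c (hGR V c) (hGR₀ V c) (hGR₁ V c) (hGR₂ V c) (hGR₃ V c) (hG_GOG V c hc) 1 -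
      slotTypeVec V c (hGR V c) (hGR₀ V c) (hGR₁ V c) (hGR₂ V c) (hGR₃ V c) (hG_GOG V c hc) 0 = μ c 1 - μ c 0)
  (hΔ₂ : ∀ {L : CMField} {ι₁ : L →+* ℂ} (V : HermSpace3 L ι₁) (c : SeesawCtx L), ∀ hc : GOG V c,
    slotTypeVec V c (hGR V c) (hGR₀ V c) (hGR₁ V c) (hGR₂ V c) (hGR₃ V c) (hG_GOG V c hc) 2 -
      slotTypeVec V c (hGR V c) (hGR₀ V c) (hGR₁ V c) (hGR₂ V c) (hGR₃ V c) (hG_GOG V c hc) 0 = μ c 2 - μ c 0)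
  (hΔ₃ : ∀ {L : CMField} {ι₁ : L →+* ℂ} (V : HermSpace3 L ι₁) (c : SeesawCtx L), ∀ hc : GOG V c,
    slotTypeVec V c (hGR V c) (hGR₀ V c) (hGR₁ V c) (hGR₂ V c) (hGR₃ V c) (hG_GOG V c hc) 3 -
      slotTypeVec V c (hGR V c) (hGR₀ V c) (hGR₁ V c) (hGR₂ V c) (hGR₃ V c) (hG_GOG V c hc) 0 = μ c 3 - μ c 0)

variable {L : CMField} {ι₁ : L →+* ℂ} (V : HermSpace3 L ι₁) (c : SeesawCtx L) (hc : GOG V c) (hV : IsAnisotropic L V.Hm)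

/-! ### § 0. The side facts of the R2 pin under the guard -/

include hc in
/-- `hP` of the pin in `lineRepOf` currency: `(P k).ω = lineRepOf … (etaT₀ η ν) (etaT₁ η ν) (etaT₂ η ν′) (etaT₃ η ν′) k`
(#1229 `SROGT'C_P_ω`; `lineRepT'` is the reducible wrapper of `lineRepOf` at the twisted characters). -/
theorem SROGT'C_P_ω_lineRepOf (k : Fin 4) :
    ((SROGT'C @hGR @hGR₀ @hGR₁ @hGR₂ @hGR₃ @μ hΔ₁ hΔ₂ hΔ₃ V c).P k).ω = lineRepOf V c.D (hGR V c) (hGR₀ V c) (hGR₁ V c) (hGR₂ V c) (hGR₃ V c)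
      (etaT₀ V c.D (EtaChi.η (@χVR @hGR @hGR₀ @hGR₁) (@χWR @hGR @hGR₀ @hGR₁ @μ) V c) (νR @hGR₁ V c)) (etaT₁ V c.D (EtaChi.η (@χVR @hGR @hGR₀ @hGR₁) (@χWR @hGR @hGR₀ @hGR₁ @μ) V c) (νR @hGR₁ V c)) (etaT₂ V c.D (EtaChi.η (@χVR @hGR @hGR₀ @hGR₁) (@χWR @hGR @hGR₀ @hGR₁ @μ) V c) (ν'R @hGR₃ V c)) (etaT₃ V c.D (EtaChi.η (@χVR @hGR @hGR₀ @hGR₁) (@χWR @hGR @hGR₀ @hGR₁ @μ) V c) (ν'R @hGR₃ V c)) k :=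
  SROGT'C_P_ω @hGR @hGR₀ @hGR₁ @hGR₂ @hGR₃ @μ hΔ₁ hΔ₂ hΔ₃ V c hc k

include hc in
/-- `hGfin` of the pin: every saturation group `satG hV K` lies in the pin's `Gfin` (`= archFinOf V` under the guard). -/
theorem satG_le_SROGT'C_Gfin (K : Subgroup ↥V.adelicFin) : ThetaDistDatum.satG hV K ≤ (SROGT'C @hGR @hGR₀ @hGR₁ @hGR₂ @hGR₃ @μ hΔ₁ hΔ₂ hΔ₃ V c).Gfin := by
  rw [SROGT'C_Gfin @hGR @hGR₀ @hGR₁ @hGR₂ @hGR₃ @μ hΔ₁ hΔ₂ hΔ₃ V c hc]; exact satLevelRegimeOf_le_archFinOf V hV K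

/-! ### § 1. Slot 0 at the R2 pin -/

include hc in
/-- **binder-1's slot-0 product Weil datum AT THE R2 PIN OF RECORD** — #R129 `pinDatumZeroG` at `S := SROGT'C … V c`,
`χ_j := etaT_j …` with every pin datum supplied by a landed theorem (module docstring). -/
abbrev pinDatumZeroR2 : ThetaDistDatum (SROGT'C @hGR @hGR₀ @hGR₁ @hGR₂ @hGR₃ @μ hΔ₁ hΔ₂ hΔ₃ V c) hV 0 :=
  pinDatumZeroG V c (SROGT'C @hGR @hGR₀ @hGR₁ @hGR₂ @hGR₃ @μ hΔ₁ hΔ₂ hΔ₃ V c) (hGR V c) (hGR₀ V c) (hGR₁ V c) (hGR₂ V c) (hGR₃ V c)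
    (etaT₀ V c.D (EtaChi.η (@χVR @hGR @hGR₀ @hGR₁) (@χWR @hGR @hGR₀ @hGR₁ @μ) V c) (νR @hGR₁ V c)) (etaT₁ V c.D (EtaChi.η (@χVR @hGR @hGR₀ @hGR₁) (@χWR @hGR @hGR₀ @hGR₁ @μ) V c) (νR @hGR₁ V c)) (etaT₂ V c.D (EtaChi.η (@χVR @hGR @hGR₀ @hGR₁) (@χWR @hGR @hGR₀ @hGR₁ @μ) V c) (ν'R @hGR₃ V c)) (etaT₃ V c.D (EtaChi.η (@χVR @hGR @hGR₀ @hGR₁) (@χWR @hGR @hGR₀ @hGR₁ @μ) V c) (ν'R @hGR₃ V c))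
    (SROGT'C_ιinf @hGR @hGR₀ @hGR₁ @hGR₂ @hGR₃ @μ hΔ₁ hΔ₂ hΔ₃ V c hc) (hG_GOG V c hc) hV hc.1
    (SROGT'C_P_ω_lineRepOf @hGR @hGR₀ @hGR₁ @hGR₂ @hGR₃ @μ hΔ₁ hΔ₂ hΔ₃ V c hc 0)
    (continuous_etaT₀ V c.D _ _ (EtaChi.hηc (@χVR @hGR @hGR₀ @hGR₁) (@χWR @hGR @hGR₀ @hGR₁ @μ) V c) (hνcR @hGR₁ V c))
    (posIdxEquivUnit (hpos_GOG V c hc).1) (negIdxEquivEmpty (hpos_GOG V c hc).1)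
    (hχ_zero_ROGTC @hGR @hGR₀ @hGR₁ @μ V c hc)
    (defExponentZero V c (hGR₀ V c) (hpos_GOG V c hc).1) (defExponentZero_spec V c (hGR₀ V c) (hpos_GOG V c hc).1)
    (hdef_zero_ROGTC @hGR @hGR₀ @hGR₁ @μ V c hc)

/-- **`hfam` clause 2 AT THE R2 PIN OF RECORD, slot 0, for saturated ADELIC THETA FORMS — no pin hypothesis left**: for weight functions
`𝓕 ⊆ {charInv χ}`, EVERY `F ∈ adelicThetaSpanSat ((SROGT'C … V c).P 0) _ _ _ (satG hV K) 𝓕` lies in `holSatU` and its tower class lies in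
`⨆_{χ, charInv χ ∈ 𝓕} block(Ω_0(χ))`, `Ω_0(χ) = ((pinDatumZeroR2 …).coinvRep χ).asModule` (#R130 `…_pinZeroG`; `hGfin`/`hLF` by § 0 / `hLF_ROGT'C`). -/
theorem clsU_mem_iSup_block_of_mem_adelicThetaSpanSat_ROGT'C_zero
    {𝓕 : Set C(↥(relNormOneIdeles (↥(maximalRealSubfield L)) L) ⧸ relNormOneRat (↥(maximalRealSubfield L)) L, ℂ)}
    (h𝓕 : ∀ f ∈ 𝓕, ∃ χ : PontryaginDual (↥(relNormOneIdeles (↥(maximalRealSubfield L)) L) ⧸ relNormOneRat (↥(maximalRealSubfield L)) L),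
      f = charInv χ)
    (K : Subgroup ↥V.adelicFin)
    {F : (V.latticeModel printFact_unitaryCompact_holds).G → (Fin 2 → ℂ)}
    (hF : F ∈ adelicThetaSpanSat ((SROGT'C @hGR @hGR₀ @hGR₁ @hGR₂ @hGR₃ @μ hΔ₁ hΔ₂ hΔ₃ V c).P 0) (SROGT'C @hGR @hGR₀ @hGR₁ @hGR₂ @hGR₃ @μ hΔ₁ hΔ₂ hΔ₃ V c).ιinf (stabilizer U21 x₀).subtype
      (BallForms.isPullbackCocycle_cotangentCocycle.weightOf x₀) (ThetaDistDatum.satG hV K) 𝓕) :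
    ∃ hF' : F ∈ (SROGT'C @hGR @hGR₀ @hGR₁ @hGR₂ @hGR₃ @μ hΔ₁ hΔ₂ hΔ₃ V c).holSatU hV 0 𝓕,
      (SROGT'C @hGR @hGR₀ @hGR₁ @hGR₂ @hGR₃ @μ hΔ₁ hΔ₂ hΔ₃ V c).clsU hHD hI h₁ h₃ hA 𝓕 (SROGT'C_ιinf @hGR @hGR₀ @hGR₁ @hGR₂ @hGR₃ @μ hΔ₁ hΔ₂ hΔ₃ V c hc) hV 0 ⟨F, hF'⟩ ∈
        ⨆ (χ : PontryaginDual (↥(relNormOneIdeles (↥(maximalRealSubfield L)) L) ⧸ relNormOneRat (↥(maximalRealSubfield L)) L))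
          (_ : charInv χ ∈ 𝓕),
          ⨆ ψ : ((pinDatumZeroR2 @hGR @hGR₀ @hGR₁ @hGR₂ @hGR₃ @μ hΔ₁ hΔ₂ hΔ₃ V c hc hV).coinvRep χ).asModule
              →ₗ[MonoidAlgebra ℂ ↥V.adelicFin] Tower hHD hI (ballQuotientUniformisedDatum_of h₁) h₃ hA V,
            (LinearMap.range ψ).restrictScalars ℂ :=
  clsU_mem_iSup_block_of_mem_adelicThetaSpanSat_pinZeroG hHD hI h₁ h₃ hA V c (SROGT'C @hGR @hGR₀ @hGR₁ @hGR₂ @hGR₃ @μ hΔ₁ hΔ₂ hΔ₃ V c) (hGR V c) (hGR₀ V c) (hGR₁ V c) (hGR₂ V c) (hGR₃ V c)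
    (etaT₀ V c.D (EtaChi.η (@χVR @hGR @hGR₀ @hGR₁) (@χWR @hGR @hGR₀ @hGR₁ @μ) V c) (νR @hGR₁ V c)) (etaT₁ V c.D (EtaChi.η (@χVR @hGR @hGR₀ @hGR₁) (@χWR @hGR @hGR₀ @hGR₁ @μ) V c) (νR @hGR₁ V c)) (etaT₂ V c.D (EtaChi.η (@χVR @hGR @hGR₀ @hGR₁) (@χWR @hGR @hGR₀ @hGR₁ @μ) V c) (ν'R @hGR₃ V c)) (etaT₃ V c.D (EtaChi.η (@χVR @hGR @hGR₀ @hGR₁) (@χWR @hGR @hGR₀ @hGR₁ @μ) V c) (ν'R @hGR₃ V c))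
    (SROGT'C_ιinf @hGR @hGR₀ @hGR₁ @hGR₂ @hGR₃ @μ hΔ₁ hΔ₂ hΔ₃ V c hc) (hG_GOG V c hc) hV hc.1
    (SROGT'C_P_ω_lineRepOf @hGR @hGR₀ @hGR₁ @hGR₂ @hGR₃ @μ hΔ₁ hΔ₂ hΔ₃ V c hc 0)
    (continuous_etaT₀ V c.D _ _ (EtaChi.hηc (@χVR @hGR @hGR₀ @hGR₁) (@χWR @hGR @hGR₀ @hGR₁ @μ) V c) (hνcR @hGR₁ V c))
    (posIdxEquivUnit (hpos_GOG V c hc).1) (negIdxEquivEmpty (hpos_GOG V c hc).1)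
    (hχ_zero_ROGTC @hGR @hGR₀ @hGR₁ @μ V c hc)
    (defExponentZero V c (hGR₀ V c) (hpos_GOG V c hc).1) (defExponentZero_spec V c (hGR₀ V c) (hpos_GOG V c hc).1)
    (hdef_zero_ROGTC @hGR @hGR₀ @hGR₁ @μ V c hc)
    h𝓕 (satG_le_SROGT'C_Gfin @hGR @hGR₀ @hGR₁ @hGR₂ @hGR₃ @μ hΔ₁ hΔ₂ hΔ₃ V c hc hV)
    (hLF_ROGT'C @hGR @hGR₀ @hGR₁ @hGR₂ @hGR₃ @μ hΔ₁ hΔ₂ hΔ₃ V c 0) K hF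

/-- the same for sinst-1's saturated hol-germ theta forms `holSat Γ` (`K := Γ.K`, `hF.1`). -/
theorem clsU_mem_iSup_block_of_mem_holSat_ROGT'C_zero
    {𝓕 : Set C(↥(relNormOneIdeles (↥(maximalRealSubfield L)) L) ⧸ relNormOneRat (↥(maximalRealSubfield L)) L, ℂ)}
    (h𝓕 : ∀ f ∈ 𝓕, ∃ χ : PontryaginDual (↥(relNormOneIdeles (↥(maximalRealSubfield L)) L) ⧸ relNormOneRat (↥(maximalRealSubfield L)) L),
      f = charInv χ)
    (Γ : Level V) {F : (V.latticeModel printFact_unitaryCompact_holds).G → (Fin 2 → ℂ)} (hF : F ∈ (SROGT'C @hGR @hGR₀ @hGR₁ @hGR₂ @hGR₃ @μ hΔ₁ hΔ₂ hΔ₃ V c).holSat hV 0 Γ 𝓕) :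
    ∃ hF' : F ∈ (SROGT'C @hGR @hGR₀ @hGR₁ @hGR₂ @hGR₃ @μ hΔ₁ hΔ₂ hΔ₃ V c).holSatU hV 0 𝓕,
      (SROGT'C @hGR @hGR₀ @hGR₁ @hGR₂ @hGR₃ @μ hΔ₁ hΔ₂ hΔ₃ V c).clsU hHD hI h₁ h₃ hA 𝓕 (SROGT'C_ιinf @hGR @hGR₀ @hGR₁ @hGR₂ @hGR₃ @μ hΔ₁ hΔ₂ hΔ₃ V c hc) hV 0 ⟨F, hF'⟩ ∈
        ⨆ (χ : PontryaginDual (↥(relNormOneIdeles (↥(maximalRealSubfield L)) L) ⧸ relNormOneRat (↥(maximalRealSubfield L)) L))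
          (_ : charInv χ ∈ 𝓕),
          ⨆ ψ : ((pinDatumZeroR2 @hGR @hGR₀ @hGR₁ @hGR₂ @hGR₃ @μ hΔ₁ hΔ₂ hΔ₃ V c hc hV).coinvRep χ).asModule
              →ₗ[MonoidAlgebra ℂ ↥V.adelicFin] Tower hHD hI (ballQuotientUniformisedDatum_of h₁) h₃ hA V,
            (LinearMap.range ψ).restrictScalars ℂ :=
  clsU_mem_iSup_block_of_mem_adelicThetaSpanSat_ROGT'C_zero hHD hI h₁ h₃ hA @hGR @hGR₀ @hGR₁ @hGR₂ @hGR₃ @μ hΔ₁ hΔ₂ hΔ₃ V c hc hV h𝓕 Γ.K hF.1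

/-! ### § 2. Slot 1 at the R2 pin -/

include hc in
/-- **binder-1's slot-1 product Weil datum AT THE R2 PIN OF RECORD** — #R129 `pinDatumOneG` at `S := SROGT'C … V c`,
`χ_j := etaT_j …` with every pin datum supplied by a landed theorem (module docstring). -/
abbrev pinDatumOneR2 : ThetaDistDatum (SROGT'C @hGR @hGR₀ @hGR₁ @hGR₂ @hGR₃ @μ hΔ₁ hΔ₂ hΔ₃ V c) hV 1 :=
  pinDatumOneG V c (SROGT'C @hGR @hGR₀ @hGR₁ @hGR₂ @hGR₃ @μ hΔ₁ hΔ₂ hΔ₃ V c) (hGR V c) (hGR₀ V c) (hGR₁ V c) (hGR₂ V c) (hGR₃ V c)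
    (etaT₀ V c.D (EtaChi.η (@χVR @hGR @hGR₀ @hGR₁) (@χWR @hGR @hGR₀ @hGR₁ @μ) V c) (νR @hGR₁ V c)) (etaT₁ V c.D (EtaChi.η (@χVR @hGR @hGR₀ @hGR₁) (@χWR @hGR @hGR₀ @hGR₁ @μ) V c) (νR @hGR₁ V c)) (etaT₂ V c.D (EtaChi.η (@χVR @hGR @hGR₀ @hGR₁) (@χWR @hGR @hGR₀ @hGR₁ @μ) V c) (ν'R @hGR₃ V c)) (etaT₃ V c.D (EtaChi.η (@χVR @hGR @hGR₀ @hGR₁) (@χWR @hGR @hGR₀ @hGR₁ @μ) V c) (ν'R @hGR₃ V c))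
    (SROGT'C_ιinf @hGR @hGR₀ @hGR₁ @hGR₂ @hGR₃ @μ hΔ₁ hΔ₂ hΔ₃ V c hc) (hG_GOG V c hc) hV hc.1
    (SROGT'C_P_ω_lineRepOf @hGR @hGR₀ @hGR₁ @hGR₂ @hGR₃ @μ hΔ₁ hΔ₂ hΔ₃ V c hc 1)
    (continuous_etaT₁ V c.D _ _ (EtaChi.hηc (@χVR @hGR @hGR₀ @hGR₁) (@χWR @hGR @hGR₀ @hGR₁ @μ) V c) (hνcR @hGR₁ V c))
    (posIdxEquivUnit (hpos_GOG V c hc).2.1) (negIdxEquivEmpty (hpos_GOG V c hc).2.1)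
    (hχ_one_ROGTC @hGR @hGR₀ @hGR₁ @μ V c hc)
    (defExponentOne V c (hGR₁ V c) (hpos_GOG V c hc).2.1) (defExponentOne_spec V c (hGR₁ V c) (hpos_GOG V c hc).2.1)
    (hdef_one_ROGTC @hGR @hGR₀ @hGR₁ @μ V c hc)

/-- **`hfam` clause 2 AT THE R2 PIN OF RECORD, slot 1, for saturated ADELIC THETA FORMS — no pin hypothesis left**: for weight functions
`𝓕 ⊆ {charInv χ}`, EVERY `F ∈ adelicThetaSpanSat ((SROGT'C … V c).P 1) _ _ _ (satG hV K) 𝓕` lies in `holSatU` and its tower class lies in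
`⨆_{χ, charInv χ ∈ 𝓕} block(Ω_1(χ))`, `Ω_1(χ) = ((pinDatumOneR2 …).coinvRep χ).asModule` (#R130 `…_pinOneG`; `hGfin`/`hLF` by § 0 / `hLF_ROGT'C`). -/
theorem clsU_mem_iSup_block_of_mem_adelicThetaSpanSat_ROGT'C_one
    {𝓕 : Set C(↥(relNormOneIdeles (↥(maximalRealSubfield L)) L) ⧸ relNormOneRat (↥(maximalRealSubfield L)) L, ℂ)}
    (h𝓕 : ∀ f ∈ 𝓕, ∃ χ : PontryaginDual (↥(relNormOneIdeles (↥(maximalRealSubfield L)) L) ⧸ relNormOneRat (↥(maximalRealSubfield L)) L),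
      f = charInv χ)
    (K : Subgroup ↥V.adelicFin)
    {F : (V.latticeModel printFact_unitaryCompact_holds).G → (Fin 2 → ℂ)}
    (hF : F ∈ adelicThetaSpanSat ((SROGT'C @hGR @hGR₀ @hGR₁ @hGR₂ @hGR₃ @μ hΔ₁ hΔ₂ hΔ₃ V c).P 1) (SROGT'C @hGR @hGR₀ @hGR₁ @hGR₂ @hGR₃ @μ hΔ₁ hΔ₂ hΔ₃ V c).ιinf (stabilizer U21 x₀).subtype
      (BallForms.isPullbackCocycle_cotangentCocycle.weightOf x₀) (ThetaDistDatum.satG hV K) 𝓕) :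
    ∃ hF' : F ∈ (SROGT'C @hGR @hGR₀ @hGR₁ @hGR₂ @hGR₃ @μ hΔ₁ hΔ₂ hΔ₃ V c).holSatU hV 1 𝓕,
      (SROGT'C @hGR @hGR₀ @hGR₁ @hGR₂ @hGR₃ @μ hΔ₁ hΔ₂ hΔ₃ V c).clsU hHD hI h₁ h₃ hA 𝓕 (SROGT'C_ιinf @hGR @hGR₀ @hGR₁ @hGR₂ @hGR₃ @μ hΔ₁ hΔ₂ hΔ₃ V c hc) hV 1 ⟨F, hF'⟩ ∈
        ⨆ (χ : PontryaginDual (↥(relNormOneIdeles (↥(maximalRealSubfield L)) L) ⧸ relNormOneRat (↥(maximalRealSubfield L)) L))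
          (_ : charInv χ ∈ 𝓕),
          ⨆ ψ : ((pinDatumOneR2 @hGR @hGR₀ @hGR₁ @hGR₂ @hGR₃ @μ hΔ₁ hΔ₂ hΔ₃ V c hc hV).coinvRep χ).asModule
              →ₗ[MonoidAlgebra ℂ ↥V.adelicFin] Tower hHD hI (ballQuotientUniformisedDatum_of h₁) h₃ hA V,
            (LinearMap.range ψ).restrictScalars ℂ :=
  clsU_mem_iSup_block_of_mem_adelicThetaSpanSat_pinOneG hHD hI h₁ h₃ hA V c (SROGT'C @hGR @hGR₀ @hGR₁ @hGR₂ @hGR₃ @μ hΔ₁ hΔ₂ hΔ₃ V c) (hGR V c) (hGR₀ V c) (hGR₁ V c) (hGR₂ V c) (hGR₃ V c)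
    (etaT₀ V c.D (EtaChi.η (@χVR @hGR @hGR₀ @hGR₁) (@χWR @hGR @hGR₀ @hGR₁ @μ) V c) (νR @hGR₁ V c)) (etaT₁ V c.D (EtaChi.η (@χVR @hGR @hGR₀ @hGR₁) (@χWR @hGR @hGR₀ @hGR₁ @μ) V c) (νR @hGR₁ V c)) (etaT₂ V c.D (EtaChi.η (@χVR @hGR @hGR₀ @hGR₁) (@χWR @hGR @hGR₀ @hGR₁ @μ) V c) (ν'R @hGR₃ V c)) (etaT₃ V c.D (EtaChi.η (@χVR @hGR @hGR₀ @hGR₁) (@χWR @hGR @hGR₀ @hGR₁ @μ) V c) (ν'R @hGR₃ V c))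
    (SROGT'C_ιinf @hGR @hGR₀ @hGR₁ @hGR₂ @hGR₃ @μ hΔ₁ hΔ₂ hΔ₃ V c hc) (hG_GOG V c hc) hV hc.1
    (SROGT'C_P_ω_lineRepOf @hGR @hGR₀ @hGR₁ @hGR₂ @hGR₃ @μ hΔ₁ hΔ₂ hΔ₃ V c hc 1)
    (continuous_etaT₁ V c.D _ _ (EtaChi.hηc (@χVR @hGR @hGR₀ @hGR₁) (@χWR @hGR @hGR₀ @hGR₁ @μ) V c) (hνcR @hGR₁ V c))
    (posIdxEquivUnit (hpos_GOG V c hc).2.1) (negIdxEquivEmpty (hpos_GOG V c hc).2.1)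
    (hχ_one_ROGTC @hGR @hGR₀ @hGR₁ @μ V c hc)
    (defExponentOne V c (hGR₁ V c) (hpos_GOG V c hc).2.1) (defExponentOne_spec V c (hGR₁ V c) (hpos_GOG V c hc).2.1)
    (hdef_one_ROGTC @hGR @hGR₀ @hGR₁ @μ V c hc)
    h𝓕 (satG_le_SROGT'C_Gfin @hGR @hGR₀ @hGR₁ @hGR₂ @hGR₃ @μ hΔ₁ hΔ₂ hΔ₃ V c hc hV)
    (hLF_ROGT'C @hGR @hGR₀ @hGR₁ @hGR₂ @hGR₃ @μ hΔ₁ hΔ₂ hΔ₃ V c 1) K hF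

/-- the same for sinst-1's saturated hol-germ theta forms `holSat Γ` (`K := Γ.K`, `hF.1`). -/
theorem clsU_mem_iSup_block_of_mem_holSat_ROGT'C_one
    {𝓕 : Set C(↥(relNormOneIdeles (↥(maximalRealSubfield L)) L) ⧸ relNormOneRat (↥(maximalRealSubfield L)) L, ℂ)}
    (h𝓕 : ∀ f ∈ 𝓕, ∃ χ : PontryaginDual (↥(relNormOneIdeles (↥(maximalRealSubfield L)) L) ⧸ relNormOneRat (↥(maximalRealSubfield L)) L),
      f = charInv χ)
    (Γ : Level V) {F : (V.latticeModel printFact_unitaryCompact_holds).G → (Fin 2 → ℂ)} (hF : F ∈ (SROGT'C @hGR @hGR₀ @hGR₁ @hGR₂ @hGR₃ @μ hΔ₁ hΔ₂ hΔ₃ V c).holSat hV 1 Γ 𝓕) :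
    ∃ hF' : F ∈ (SROGT'C @hGR @hGR₀ @hGR₁ @hGR₂ @hGR₃ @μ hΔ₁ hΔ₂ hΔ₃ V c).holSatU hV 1 𝓕,
      (SROGT'C @hGR @hGR₀ @hGR₁ @hGR₂ @hGR₃ @μ hΔ₁ hΔ₂ hΔ₃ V c).clsU hHD hI h₁ h₃ hA 𝓕 (SROGT'C_ιinf @hGR @hGR₀ @hGR₁ @hGR₂ @hGR₃ @μ hΔ₁ hΔ₂ hΔ₃ V c hc) hV 1 ⟨F, hF'⟩ ∈
        ⨆ (χ : PontryaginDual (↥(relNormOneIdeles (↥(maximalRealSubfield L)) L) ⧸ relNormOneRat (↥(maximalRealSubfield L)) L))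
          (_ : charInv χ ∈ 𝓕),
          ⨆ ψ : ((pinDatumOneR2 @hGR @hGR₀ @hGR₁ @hGR₂ @hGR₃ @μ hΔ₁ hΔ₂ hΔ₃ V c hc hV).coinvRep χ).asModule
              →ₗ[MonoidAlgebra ℂ ↥V.adelicFin] Tower hHD hI (ballQuotientUniformisedDatum_of h₁) h₃ hA V,
            (LinearMap.range ψ).restrictScalars ℂ :=
  clsU_mem_iSup_block_of_mem_adelicThetaSpanSat_ROGT'C_one hHD hI h₁ h₃ hA @hGR @hGR₀ @hGR₁ @hGR₂ @hGR₃ @μ hΔ₁ hΔ₂ hΔ₃ V c hc hV h𝓕 Γ.K hF.1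

/-! ### § 3. Slot 2 at the R2 pin -/

include hc in
/-- **binder-1's slot-2 product Weil datum AT THE R2 PIN OF RECORD** — #R129 `pinDatumTwoG` at `S := SROGT'C … V c`,
`χ_j := etaT_j …` with every pin datum supplied by a landed theorem (module docstring). -/
abbrev pinDatumTwoR2 : ThetaDistDatum (SROGT'C @hGR @hGR₀ @hGR₁ @hGR₂ @hGR₃ @μ hΔ₁ hΔ₂ hΔ₃ V c) hV 2 :=
  pinDatumTwoG V c (SROGT'C @hGR @hGR₀ @hGR₁ @hGR₂ @hGR₃ @μ hΔ₁ hΔ₂ hΔ₃ V c) (hGR V c) (hGR₀ V c) (hGR₁ V c) (hGR₂ V c) (hGR₃ V c)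
    (etaT₀ V c.D (EtaChi.η (@χVR @hGR @hGR₀ @hGR₁) (@χWR @hGR @hGR₀ @hGR₁ @μ) V c) (νR @hGR₁ V c)) (etaT₁ V c.D (EtaChi.η (@χVR @hGR @hGR₀ @hGR₁) (@χWR @hGR @hGR₀ @hGR₁ @μ) V c) (νR @hGR₁ V c)) (etaT₂ V c.D (EtaChi.η (@χVR @hGR @hGR₀ @hGR₁) (@χWR @hGR @hGR₀ @hGR₁ @μ) V c) (ν'R @hGR₃ V c)) (etaT₃ V c.D (EtaChi.η (@χVR @hGR @hGR₀ @hGR₁) (@χWR @hGR @hGR₀ @hGR₁ @μ) V c) (ν'R @hGR₃ V c))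
    (SROGT'C_ιinf @hGR @hGR₀ @hGR₁ @hGR₂ @hGR₃ @μ hΔ₁ hΔ₂ hΔ₃ V c hc) (hG_GOG V c hc) hV hc.1
    (SROGT'C_P_ω_lineRepOf @hGR @hGR₀ @hGR₁ @hGR₂ @hGR₃ @μ hΔ₁ hΔ₂ hΔ₃ V c hc 2)
    (continuous_etaT₂ V c.D _ _ (EtaChi.hηc (@χVR @hGR @hGR₀ @hGR₁) (@χWR @hGR @hGR₀ @hGR₁ @μ) V c) (hν'cR @hGR₃ V c))
    (posIdxEquivUnit (hpos_GOG V c hc).2.2.1) (negIdxEquivEmpty (hpos_GOG V c hc).2.2.1)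
    (hχ_two_R2_of_GOG @hGR @hGR₀ @hGR₁ @hGR₂ @hGR₃ (@χWR @hGR @hGR₀ @hGR₁ @μ) V c hc)
    (defExponentTwo V c (hGR₂ V c) (hpos_GOG V c hc).2.2.1) (defExponentTwo_spec V c (hGR₂ V c) (hpos_GOG V c hc).2.2.1)
    (hdef_two_R2_of_GOG @hGR @hGR₀ @hGR₁ @hGR₂ @hGR₃ (@χWR @hGR @hGR₀ @hGR₁ @μ) V c hc)

/-- **`hfam` clause 2 AT THE R2 PIN OF RECORD, slot 2, for saturated ADELIC THETA FORMS — no pin hypothesis left**: for weight functions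
`𝓕 ⊆ {charInv χ}`, EVERY `F ∈ adelicThetaSpanSat ((SROGT'C … V c).P 2) _ _ _ (satG hV K) 𝓕` lies in `holSatU` and its tower class lies in
`⨆_{χ, charInv χ ∈ 𝓕} block(Ω_2(χ))`, `Ω_2(χ) = ((pinDatumTwoR2 …).coinvRep χ).asModule` (#R130 `…_pinTwoG`; `hGfin`/`hLF` by § 0 / `hLF_ROGT'C`). -/
theorem clsU_mem_iSup_block_of_mem_adelicThetaSpanSat_ROGT'C_two
    {𝓕 : Set C(↥(relNormOneIdeles (↥(maximalRealSubfield L)) L) ⧸ relNormOneRat (↥(maximalRealSubfield L)) L, ℂ)}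
    (h𝓕 : ∀ f ∈ 𝓕, ∃ χ : PontryaginDual (↥(relNormOneIdeles (↥(maximalRealSubfield L)) L) ⧸ relNormOneRat (↥(maximalRealSubfield L)) L),
      f = charInv χ)
    (K : Subgroup ↥V.adelicFin)
    {F : (V.latticeModel printFact_unitaryCompact_holds).G → (Fin 2 → ℂ)}
    (hF : F ∈ adelicThetaSpanSat ((SROGT'C @hGR @hGR₀ @hGR₁ @hGR₂ @hGR₃ @μ hΔ₁ hΔ₂ hΔ₃ V c).P 2) (SROGT'C @hGR @hGR₀ @hGR₁ @hGR₂ @hGR₃ @μ hΔ₁ hΔ₂ hΔ₃ V c).ιinf (stabilizer U21 x₀).subtype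
      (BallForms.isPullbackCocycle_cotangentCocycle.weightOf x₀) (ThetaDistDatum.satG hV K) 𝓕) :
    ∃ hF' : F ∈ (SROGT'C @hGR @hGR₀ @hGR₁ @hGR₂ @hGR₃ @μ hΔ₁ hΔ₂ hΔ₃ V c).holSatU hV 2 𝓕,
      (SROGT'C @hGR @hGR₀ @hGR₁ @hGR₂ @hGR₃ @μ hΔ₁ hΔ₂ hΔ₃ V c).clsU hHD hI h₁ h₃ hA 𝓕 (SROGT'C_ιinf @hGR @hGR₀ @hGR₁ @hGR₂ @hGR₃ @μ hΔ₁ hΔ₂ hΔ₃ V c hc) hV 2 ⟨F, hF'⟩ ∈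
        ⨆ (χ : PontryaginDual (↥(relNormOneIdeles (↥(maximalRealSubfield L)) L) ⧸ relNormOneRat (↥(maximalRealSubfield L)) L))
          (_ : charInv χ ∈ 𝓕),
          ⨆ ψ : ((pinDatumTwoR2 @hGR @hGR₀ @hGR₁ @hGR₂ @hGR₃ @μ hΔ₁ hΔ₂ hΔ₃ V c hc hV).coinvRep χ).asModule
              →ₗ[MonoidAlgebra ℂ ↥V.adelicFin] Tower hHD hI (ballQuotientUniformisedDatum_of h₁) h₃ hA V,
            (LinearMap.range ψ).restrictScalars ℂ :=
  clsU_mem_iSup_block_of_mem_adelicThetaSpanSat_pinTwoG hHD hI h₁ h₃ hA V c (SROGT'C @hGR @hGR₀ @hGR₁ @hGR₂ @hGR₃ @μ hΔ₁ hΔ₂ hΔ₃ V c) (hGR V c) (hGR₀ V c) (hGR₁ V c) (hGR₂ V c) (hGR₃ V c)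
    (etaT₀ V c.D (EtaChi.η (@χVR @hGR @hGR₀ @hGR₁) (@χWR @hGR @hGR₀ @hGR₁ @μ) V c) (νR @hGR₁ V c)) (etaT₁ V c.D (EtaChi.η (@χVR @hGR @hGR₀ @hGR₁) (@χWR @hGR @hGR₀ @hGR₁ @μ) V c) (νR @hGR₁ V c)) (etaT₂ V c.D (EtaChi.η (@χVR @hGR @hGR₀ @hGR₁) (@χWR @hGR @hGR₀ @hGR₁ @μ) V c) (ν'R @hGR₃ V c)) (etaT₃ V c.D (EtaChi.η (@χVR @hGR @hGR₀ @hGR₁) (@χWR @hGR @hGR₀ @hGR₁ @μ) V c) (ν'R @hGR₃ V c))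
    (SROGT'C_ιinf @hGR @hGR₀ @hGR₁ @hGR₂ @hGR₃ @μ hΔ₁ hΔ₂ hΔ₃ V c hc) (hG_GOG V c hc) hV hc.1
    (SROGT'C_P_ω_lineRepOf @hGR @hGR₀ @hGR₁ @hGR₂ @hGR₃ @μ hΔ₁ hΔ₂ hΔ₃ V c hc 2)
    (continuous_etaT₂ V c.D _ _ (EtaChi.hηc (@χVR @hGR @hGR₀ @hGR₁) (@χWR @hGR @hGR₀ @hGR₁ @μ) V c) (hν'cR @hGR₃ V c))
    (posIdxEquivUnit (hpos_GOG V c hc).2.2.1) (negIdxEquivEmpty (hpos_GOG V c hc).2.2.1)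
    (hχ_two_R2_of_GOG @hGR @hGR₀ @hGR₁ @hGR₂ @hGR₃ (@χWR @hGR @hGR₀ @hGR₁ @μ) V c hc)
    (defExponentTwo V c (hGR₂ V c) (hpos_GOG V c hc).2.2.1) (defExponentTwo_spec V c (hGR₂ V c) (hpos_GOG V c hc).2.2.1)
    (hdef_two_R2_of_GOG @hGR @hGR₀ @hGR₁ @hGR₂ @hGR₃ (@χWR @hGR @hGR₀ @hGR₁ @μ) V c hc)
    h𝓕 (satG_le_SROGT'C_Gfin @hGR @hGR₀ @hGR₁ @hGR₂ @hGR₃ @μ hΔ₁ hΔ₂ hΔ₃ V c hc hV)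
    (hLF_ROGT'C @hGR @hGR₀ @hGR₁ @hGR₂ @hGR₃ @μ hΔ₁ hΔ₂ hΔ₃ V c 2) K hF

/-- the same for sinst-1's saturated hol-germ theta forms `holSat Γ` (`K := Γ.K`, `hF.1`). -/
theorem clsU_mem_iSup_block_of_mem_holSat_ROGT'C_two
    {𝓕 : Set C(↥(relNormOneIdeles (↥(maximalRealSubfield L)) L) ⧸ relNormOneRat (↥(maximalRealSubfield L)) L, ℂ)}
    (h𝓕 : ∀ f ∈ 𝓕, ∃ χ : PontryaginDual (↥(relNormOneIdeles (↥(maximalRealSubfield L)) L) ⧸ relNormOneRat (↥(maximalRealSubfield L)) L),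
      f = charInv χ)
    (Γ : Level V) {F : (V.latticeModel printFact_unitaryCompact_holds).G → (Fin 2 → ℂ)} (hF : F ∈ (SROGT'C @hGR @hGR₀ @hGR₁ @hGR₂ @hGR₃ @μ hΔ₁ hΔ₂ hΔ₃ V c).holSat hV 2 Γ 𝓕) :
    ∃ hF' : F ∈ (SROGT'C @hGR @hGR₀ @hGR₁ @hGR₂ @hGR₃ @μ hΔ₁ hΔ₂ hΔ₃ V c).holSatU hV 2 𝓕,
      (SROGT'C @hGR @hGR₀ @hGR₁ @hGR₂ @hGR₃ @μ hΔ₁ hΔ₂ hΔ₃ V c).clsU hHD hI h₁ h₃ hA 𝓕 (SROGT'C_ιinf @hGR @hGR₀ @hGR₁ @hGR₂ @hGR₃ @μ hΔ₁ hΔ₂ hΔ₃ V c hc) hV 2 ⟨F, hF'⟩ ∈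
        ⨆ (χ : PontryaginDual (↥(relNormOneIdeles (↥(maximalRealSubfield L)) L) ⧸ relNormOneRat (↥(maximalRealSubfield L)) L))
          (_ : charInv χ ∈ 𝓕),
          ⨆ ψ : ((pinDatumTwoR2 @hGR @hGR₀ @hGR₁ @hGR₂ @hGR₃ @μ hΔ₁ hΔ₂ hΔ₃ V c hc hV).coinvRep χ).asModule
              →ₗ[MonoidAlgebra ℂ ↥V.adelicFin] Tower hHD hI (ballQuotientUniformisedDatum_of h₁) h₃ hA V,
            (LinearMap.range ψ).restrictScalars ℂ :=
  clsU_mem_iSup_block_of_mem_adelicThetaSpanSat_ROGT'C_two hHD hI h₁ h₃ hA @hGR @hGR₀ @hGR₁ @hGR₂ @hGR₃ @μ hΔ₁ hΔ₂ hΔ₃ V c hc hV h𝓕 Γ.K hF.1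

/-! ### § 4. Slot 3 at the R2 pin -/

include hc in
/-- **binder-1's slot-3 product Weil datum AT THE R2 PIN OF RECORD** — #R129 `pinDatumThreeG` at `S := SROGT'C … V c`,
`χ_j := etaT_j …` with every pin datum supplied by a landed theorem (module docstring). -/
abbrev pinDatumThreeR2 : ThetaDistDatum (SROGT'C @hGR @hGR₀ @hGR₁ @hGR₂ @hGR₃ @μ hΔ₁ hΔ₂ hΔ₃ V c) hV 3 :=
  pinDatumThreeG V c (SROGT'C @hGR @hGR₀ @hGR₁ @hGR₂ @hGR₃ @μ hΔ₁ hΔ₂ hΔ₃ V c) (hGR V c) (hGR₀ V c) (hGR₁ V c) (hGR₂ V c) (hGR₃ V c)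
    (etaT₀ V c.D (EtaChi.η (@χVR @hGR @hGR₀ @hGR₁) (@χWR @hGR @hGR₀ @hGR₁ @μ) V c) (νR @hGR₁ V c)) (etaT₁ V c.D (EtaChi.η (@χVR @hGR @hGR₀ @hGR₁) (@χWR @hGR @hGR₀ @hGR₁ @μ) V c) (νR @hGR₁ V c)) (etaT₂ V c.D (EtaChi.η (@χVR @hGR @hGR₀ @hGR₁) (@χWR @hGR @hGR₀ @hGR₁ @μ) V c) (ν'R @hGR₃ V c)) (etaT₃ V c.D (EtaChi.η (@χVR @hGR @hGR₀ @hGR₁) (@χWR @hGR @hGR₀ @hGR₁ @μ) V c) (ν'R @hGR₃ V c))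
    (SROGT'C_ιinf @hGR @hGR₀ @hGR₁ @hGR₂ @hGR₃ @μ hΔ₁ hΔ₂ hΔ₃ V c hc) hV hc.1
    (SROGT'C_P_ω_lineRepOf @hGR @hGR₀ @hGR₁ @hGR₂ @hGR₃ @μ hΔ₁ hΔ₂ hΔ₃ V c hc 3)
    (continuous_etaT₃ V c.D _ _ (EtaChi.hηc (@χVR @hGR @hGR₀ @hGR₁) (@χWR @hGR @hGR₀ @hGR₁ @μ) V c) (hν'cR @hGR₃ V c))
    (posIdxEquivUnit (hpos_GOG V c hc).2.2.2) (negIdxEquivEmpty (hpos_GOG V c hc).2.2.2)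
    (hχ_three_R2_of_GOG @hGR @hGR₀ @hGR₁ @hGR₂ @hGR₃ (@χWR @hGR @hGR₀ @hGR₁ @μ) V c hc)
    (defExponentThree V c (hGR₃ V c) (hpos_GOG V c hc).2.2.2) (defExponentThree_spec V c (hGR₃ V c) (hpos_GOG V c hc).2.2.2)
    (hdef_three_R2_of_GOG @hGR @hGR₀ @hGR₁ @hGR₂ @hGR₃ (@χWR @hGR @hGR₀ @hGR₁ @μ) V c hc)

/-- **`hfam` clause 2 AT THE R2 PIN OF RECORD, slot 3, for saturated ADELIC THETA FORMS — no pin hypothesis left**: for weight functions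
`𝓕 ⊆ {charInv χ}`, EVERY `F ∈ adelicThetaSpanSat ((SROGT'C … V c).P 3) _ _ _ (satG hV K) 𝓕` lies in `holSatU` and its tower class lies in
`⨆_{χ, charInv χ ∈ 𝓕} block(Ω_3(χ))`, `Ω_3(χ) = ((pinDatumThreeR2 …).coinvRep χ).asModule` (#R130 `…_pinThreeG`; `hGfin`/`hLF` by § 0 / `hLF_ROGT'C`). -/
theorem clsU_mem_iSup_block_of_mem_adelicThetaSpanSat_ROGT'C_three
    {𝓕 : Set C(↥(relNormOneIdeles (↥(maximalRealSubfield L)) L) ⧸ relNormOneRat (↥(maximalRealSubfield L)) L, ℂ)}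
    (h𝓕 : ∀ f ∈ 𝓕, ∃ χ : PontryaginDual (↥(relNormOneIdeles (↥(maximalRealSubfield L)) L) ⧸ relNormOneRat (↥(maximalRealSubfield L)) L),
      f = charInv χ)
    (K : Subgroup ↥V.adelicFin)
    {F : (V.latticeModel printFact_unitaryCompact_holds).G → (Fin 2 → ℂ)}
    (hF : F ∈ adelicThetaSpanSat ((SROGT'C @hGR @hGR₀ @hGR₁ @hGR₂ @hGR₃ @μ hΔ₁ hΔ₂ hΔ₃ V c).P 3) (SROGT'C @hGR @hGR₀ @hGR₁ @hGR₂ @hGR₃ @μ hΔ₁ hΔ₂ hΔ₃ V c).ιinf (stabilizer U21 x₀).subtype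
      (BallForms.isPullbackCocycle_cotangentCocycle.weightOf x₀) (ThetaDistDatum.satG hV K) 𝓕) :
    ∃ hF' : F ∈ (SROGT'C @hGR @hGR₀ @hGR₁ @hGR₂ @hGR₃ @μ hΔ₁ hΔ₂ hΔ₃ V c).holSatU hV 3 𝓕,
      (SROGT'C @hGR @hGR₀ @hGR₁ @hGR₂ @hGR₃ @μ hΔ₁ hΔ₂ hΔ₃ V c).clsU hHD hI h₁ h₃ hA 𝓕 (SROGT'C_ιinf @hGR @hGR₀ @hGR₁ @hGR₂ @hGR₃ @μ hΔ₁ hΔ₂ hΔ₃ V c hc) hV 3 ⟨F, hF'⟩ ∈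
        ⨆ (χ : PontryaginDual (↥(relNormOneIdeles (↥(maximalRealSubfield L)) L) ⧸ relNormOneRat (↥(maximalRealSubfield L)) L))
          (_ : charInv χ ∈ 𝓕),
          ⨆ ψ : ((pinDatumThreeR2 @hGR @hGR₀ @hGR₁ @hGR₂ @hGR₃ @μ hΔ₁ hΔ₂ hΔ₃ V c hc hV).coinvRep χ).asModule
              →ₗ[MonoidAlgebra ℂ ↥V.adelicFin] Tower hHD hI (ballQuotientUniformisedDatum_of h₁) h₃ hA V,
            (LinearMap.range ψ).restrictScalars ℂ :=
  clsU_mem_iSup_block_of_mem_adelicThetaSpanSat_pinThreeG hHD hI h₁ h₃ hA V c (SROGT'C @hGR @hGR₀ @hGR₁ @hGR₂ @hGR₃ @μ hΔ₁ hΔ₂ hΔ₃ V c) (hGR V c) (hGR₀ V c) (hGR₁ V c) (hGR₂ V c) (hGR₃ V c)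
    (etaT₀ V c.D (EtaChi.η (@χVR @hGR @hGR₀ @hGR₁) (@χWR @hGR @hGR₀ @hGR₁ @μ) V c) (νR @hGR₁ V c)) (etaT₁ V c.D (EtaChi.η (@χVR @hGR @hGR₀ @hGR₁) (@χWR @hGR @hGR₀ @hGR₁ @μ) V c) (νR @hGR₁ V c)) (etaT₂ V c.D (EtaChi.η (@χVR @hGR @hGR₀ @hGR₁) (@χWR @hGR @hGR₀ @hGR₁ @μ) V c) (ν'R @hGR₃ V c)) (etaT₃ V c.D (EtaChi.η (@χVR @hGR @hGR₀ @hGR₁) (@χWR @hGR @hGR₀ @hGR₁ @μ) V c) (ν'R @hGR₃ V c))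
    (SROGT'C_ιinf @hGR @hGR₀ @hGR₁ @hGR₂ @hGR₃ @μ hΔ₁ hΔ₂ hΔ₃ V c hc) hV hc.1
    (SROGT'C_P_ω_lineRepOf @hGR @hGR₀ @hGR₁ @hGR₂ @hGR₃ @μ hΔ₁ hΔ₂ hΔ₃ V c hc 3)
    (continuous_etaT₃ V c.D _ _ (EtaChi.hηc (@χVR @hGR @hGR₀ @hGR₁) (@χWR @hGR @hGR₀ @hGR₁ @μ) V c) (hν'cR @hGR₃ V c))
    (posIdxEquivUnit (hpos_GOG V c hc).2.2.2) (negIdxEquivEmpty (hpos_GOG V c hc).2.2.2)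
    (hχ_three_R2_of_GOG @hGR @hGR₀ @hGR₁ @hGR₂ @hGR₃ (@χWR @hGR @hGR₀ @hGR₁ @μ) V c hc)
    (defExponentThree V c (hGR₃ V c) (hpos_GOG V c hc).2.2.2) (defExponentThree_spec V c (hGR₃ V c) (hpos_GOG V c hc).2.2.2)
    (hdef_three_R2_of_GOG @hGR @hGR₀ @hGR₁ @hGR₂ @hGR₃ (@χWR @hGR @hGR₀ @hGR₁ @μ) V c hc)
    h𝓕 (satG_le_SROGT'C_Gfin @hGR @hGR₀ @hGR₁ @hGR₂ @hGR₃ @μ hΔ₁ hΔ₂ hΔ₃ V c hc hV)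
    (hLF_ROGT'C @hGR @hGR₀ @hGR₁ @hGR₂ @hGR₃ @μ hΔ₁ hΔ₂ hΔ₃ V c 3) K hF

/-- the same for sinst-1's saturated hol-germ theta forms `holSat Γ` (`K := Γ.K`, `hF.1`). -/
theorem clsU_mem_iSup_block_of_mem_holSat_ROGT'C_three
    {𝓕 : Set C(↥(relNormOneIdeles (↥(maximalRealSubfield L)) L) ⧸ relNormOneRat (↥(maximalRealSubfield L)) L, ℂ)}
    (h𝓕 : ∀ f ∈ 𝓕, ∃ χ : PontryaginDual (↥(relNormOneIdeles (↥(maximalRealSubfield L)) L) ⧸ relNormOneRat (↥(maximalRealSubfield L)) L),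
      f = charInv χ)
    (Γ : Level V) {F : (V.latticeModel printFact_unitaryCompact_holds).G → (Fin 2 → ℂ)} (hF : F ∈ (SROGT'C @hGR @hGR₀ @hGR₁ @hGR₂ @hGR₃ @μ hΔ₁ hΔ₂ hΔ₃ V c).holSat hV 3 Γ 𝓕) :
    ∃ hF' : F ∈ (SROGT'C @hGR @hGR₀ @hGR₁ @hGR₂ @hGR₃ @μ hΔ₁ hΔ₂ hΔ₃ V c).holSatU hV 3 𝓕,
      (SROGT'C @hGR @hGR₀ @hGR₁ @hGR₂ @hGR₃ @μ hΔ₁ hΔ₂ hΔ₃ V c).clsU hHD hI h₁ h₃ hA 𝓕 (SROGT'C_ιinf @hGR @hGR₀ @hGR₁ @hGR₂ @hGR₃ @μ hΔ₁ hΔ₂ hΔ₃ V c hc) hV 3 ⟨F, hF'⟩ ∈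
        ⨆ (χ : PontryaginDual (↥(relNormOneIdeles (↥(maximalRealSubfield L)) L) ⧸ relNormOneRat (↥(maximalRealSubfield L)) L))
          (_ : charInv χ ∈ 𝓕),
          ⨆ ψ : ((pinDatumThreeR2 @hGR @hGR₀ @hGR₁ @hGR₂ @hGR₃ @μ hΔ₁ hΔ₂ hΔ₃ V c hc hV).coinvRep χ).asModule
              →ₗ[MonoidAlgebra ℂ ↥V.adelicFin] Tower hHD hI (ballQuotientUniformisedDatum_of h₁) h₃ hA V,
            (LinearMap.range ψ).restrictScalars ℂ :=
  clsU_mem_iSup_block_of_mem_adelicThetaSpanSat_ROGT'C_three hHD hI h₁ h₃ hA @hGR @hGR₀ @hGR₁ @hGR₂ @hGR₃ @μ hΔ₁ hΔ₂ hΔ₃ V c hc hV h𝓕 Γ.K hF.1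

end HodgeCM.Model.SInstance
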